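import Mathlib
import Literature.NumberTheory.LFunctions.Zhang2022.TypedSection16A
import Literature.NumberTheory.LFunctions.Zhang2022.TypedSection16B
import Literature.NumberTheory.LFunctions.Zhang2022.AppendixAKappa2PrimePowers
import Literature.NumberTheory.LFunctions.Zhang2022.AppendixAEulerFactorM2
import Literature.NumberTheory.LFunctions.Zhang2022.AppendixALemma161

/-!
# Zhang (2022) Appendix A, proof of Lemma 16.1 (v): the typed §16 objects at a prime — `calM2Factor c′ χ q 1 1 s` is the closed form

Topic `Literature/NumberTheory/LFunctions/Zhang2022` (Landau–Siegel audit tree; verdict-neutral).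
Y. Zhang, *Discrete mean estimates and the Landau–Siegel zero*, arXiv:2211.02515v1 (2022)
[Zhang2022LandauSiegel] — **an unrefereed manuscript under adjudication**; this file PROVES identities
between the campaign's typed objects of §16 (L4-t4 `Typed.Section16A`: `kappaTilde2`, `lam2`, `xi2`,
`lamTilde2`, `xi2LocalSeries`, `calM2Factor`; L4-t5 `Typed.Section16B`: `frakpFactor`) and the closed
forms of `AppendixAEulerFactorM2`, and asserts nothing about the manuscript's theorems. Campaign D-0069,
DAG nodes `Z22:Lem16.1.pf`, `Z22:§A.u033`–`u038` (App. A p. 105), `Z22:(16.7)`, `Z22:(16.8)`,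
`Z22:§16.u013`, `u021`, `u026`.

* `kappaTilde2_prime_pow_succ_one` — **`κ̃₂(qʳ⁺¹;1) = wʳ(w−1)/(1 − wχ(q)/q)`** (`w = q^{−ib₁}`);
* `kappaTilde2_prime_pow_q` — **`κ̃₂(qʲ;q) = κ₂(qʲ)`** (the manuscript's "`κ̃₂(q^{r−1}, dq) = κ₂(q^{r−1})`");
* `xi2_prime_pow_succ_one_one` — **`ξ₂(qʳ⁺¹;1,1) = κ̃₂(qʳ⁺¹;1) − χ(q)q/(q−1)·κ₂(qʳ)`** (App. A p. 105,
  case `(q,l) = 1`; only `k ∈ {1, q}` carry `μ(k) ≠ 0`);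
* `lamTilde2_prime_one` — `λ̃₂(q,1) = λ₂(q) = locLam`; `xi2LocalSeries_prime_one_one` — the local series
  `Σ_{r≥1} ξ₂(qʳ;1,1)q^{−rs}` IS `locSer` (two geometric series); `calM2Factor_prime_one_one` — **the
  Euler factor of `𝔪₂(1,1;s)` at `q` is `locF (χ q) (q^{−β₁}) (q^{−s}) q`**; `frakpFactor_eq_locMain`.

Sequel: `AppendixALemma161Typed` (Lemma 16.1 for `calM2star`/`frakp`).

## References
* Y. Zhang, arXiv:2211.02515v1 (2022), §16 pp. 90–92, Appendix A pp. 104–105.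
  [cite: Zhang2022LandauSiegel, §16, App. A]
-/

noncomputable section

open Complex Real Finset Filter Topology
open ArithmeticFunction hiding log

namespace Literature.NumberTheory.LFunctions.Zhang2022.AppendixA

open MeanSquareMajorant

/-! ## §5. The typed objects of §16 at a prime: `calM2Factor c′ χ q 1 1 s` is the closed form `locF` -/

section TypedBridge

open Literature.NumberTheory.LFunctions.Zhang2022.Typed

variable (c' : ℝ) {D : ℕ} (χ : DirichletCharacter ℂ D)

/-- `𝔫(1) = {1}` (§7 p. 13). [cite: Zhang2022LandauSiegel, §7 p. 13] -/
theorem mem_nset_one_iff (h : ℕ) : h ∈ Skeleton.nset 1 ↔ h = 1 := by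
  constructor
  · rintro ⟨hpos, hdiv⟩
    by_contra hne
    obtain ⟨p, hp, hph⟩ := Nat.exists_prime_and_dvd hne
    exact hp.one_lt.ne' (Nat.dvd_one.mp (hdiv p hp hph))
  · rintro rfl
    exact ⟨one_pos, fun p hp hp1 => hp1⟩

open scoped Classical in
/-- **`κ̃₂(qʳ⁺¹;1) = wʳ(w−1)/(1 − wχ(q)/q)`** (`w = q^{−ib₁}`): the typed series `kappaTilde2 c′ χ (q^{r+1}) 1 1`
in closed form (App. A p. 105 with §16 u013). [cite: Zhang2022LandauSiegel, App. A p. 105] -/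
theorem kappaTilde2_prime_pow_succ_one {q : ℕ} (hq : q.Prime) (r : ℕ) :
    Section16A.kappaTilde2 c' χ (q ^ (r + 1)) 1 1 =
      powI (Skeleton.b1 c' D) q ^ r * (powI (Skeleton.b1 c' D) q - 1) /
        (1 - powI (Skeleton.b1 c' D) q * (χ (q : ZMod D) / q)) := by
  have hq0 : (q : ℂ) ≠ 0 := by exact_mod_cast hq.ne_zero
  have hz : ‖χ (q : ZMod D) / (q : ℂ)‖ < 1 := by
    rw [norm_div, Complex.norm_natCast]
    have h1 := DirichletCharacter.norm_le_one χ (q : ZMod D)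
    have h2 : (2 : ℝ) ≤ q := by exact_mod_cast hq.two_le
    rw [div_lt_one (by linarith)]; linarith
  unfold Section16A.kappaTilde2
  have h1 := tsum_nset_prime_pow (r := r + 1) hq (by omega) (fun h => Nat.Coprime h 1)
    (fun h => Section16A.kappa2 c' D (q ^ (r + 1) * h) * χ (h : ZMod D) / (h : ℂ) ^ (1 : ℂ))
  calc (∑' h : ℕ, if h ∈ Skeleton.nset (q ^ (r + 1)) ∧ Nat.Coprime h 1 then
          Section16A.kappa2 c' D (q ^ (r + 1) * h) * χ (h : ZMod D) / (h : ℂ) ^ (1 : ℂ) else 0)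
      = ∑' i : ℕ, if Nat.Coprime (q ^ i) 1 then
          Section16A.kappa2 c' D (q ^ (r + 1) * q ^ i) * χ ((q ^ i : ℕ) : ZMod D) /
            ((q ^ i : ℕ) : ℂ) ^ (1 : ℂ) else 0 := by convert h1 using 4
    _ = ∑' i : ℕ, kappa₂ (Skeleton.b1 c' D) (q ^ (r + 1 + i)) * (χ (q : ZMod D) / q) ^ i :=
        tsum_congr fun i => by
          rw [if_pos (Nat.coprime_one_right _), Section16A.kappa2, ← pow_add, Complex.cpow_one,
            Nat.cast_pow, Nat.cast_pow, map_pow χ, div_pow, mul_div_assoc]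
    _ = _ := tsum_kappa₂_prime_pow_mul_pow (Skeleton.b1 c' D) hq r hz

open scoped Classical in
/-- **`κ̃₂(qʲ;q) = κ₂(qʲ)`** (only `h = 1` is coprime to `q`): the typed `kappaTilde2 c′ χ (q^j) q 1`
("`κ̃₂(q^{r−1}, dq) = κ₂(q^{r−1})`", App. A (A.5) pattern, p. 104). [cite: Zhang2022LandauSiegel, App. A p. 104] -/
theorem kappaTilde2_prime_pow_q {q : ℕ} (hq : q.Prime) (j : ℕ) :
    Section16A.kappaTilde2 c' χ (q ^ j) q 1 = Section16A.kappa2 c' D (q ^ j) := by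
  unfold Section16A.kappaTilde2
  rcases j with _ | j
  · rw [pow_zero, tsum_eq_single 1]
    · simp [(mem_nset_one_iff 1).mpr rfl]
    · intro h hh
      rw [if_neg]
      rintro ⟨hn, -⟩
      exact hh ((mem_nset_one_iff h).mp hn)
  · have h1 := tsum_nset_prime_pow (r := j + 1) hq (by omega) (fun h => Nat.Coprime h q)
      (fun h => Section16A.kappa2 c' D (q ^ (j + 1) * h) * χ (h : ZMod D) / (h : ℂ) ^ (1 : ℂ))
    calc (∑' h : ℕ, if h ∈ Skeleton.nset (q ^ (j + 1)) ∧ Nat.Coprime h q then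
            Section16A.kappa2 c' D (q ^ (j + 1) * h) * χ (h : ZMod D) / (h : ℂ) ^ (1 : ℂ) else 0)
        = ∑' i : ℕ, if Nat.Coprime (q ^ i) q then
            Section16A.kappa2 c' D (q ^ (j + 1) * q ^ i) * χ ((q ^ i : ℕ) : ZMod D) /
              ((q ^ i : ℕ) : ℂ) ^ (1 : ℂ) else 0 := by convert h1 using 4
      _ = Section16A.kappa2 c' D (q ^ (j + 1)) := by
          rw [tsum_eq_single 0]
          · rw [if_pos (by simp), pow_zero, mul_one, Nat.cast_one, Nat.cast_one, map_one,
              Complex.one_cpow, mul_one, div_one]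
          · intro i hi
            rw [if_neg]
            intro hc
            exact hq.ne_one (hc.symm.eq_one_of_dvd (dvd_pow_self q hi))

/-- **`ξ₂(qʳ⁺¹;1,1) = κ̃₂(qʳ⁺¹;1) − χ(q)q/(q−1)·κ₂(qʳ)`** in closed form (App. A p. 105, the case
`(q,l) = 1` of the displayed formula for `ξ₂(qʳ;d,l)`): only the divisors `k = 1` and `k = q` of `qʳ⁺¹`
carry `μ(k) ≠ 0`. [cite: Zhang2022LandauSiegel, App. A p. 105] -/
theorem xi2_prime_pow_succ_one_one {q : ℕ} (hq : q.Prime) (r : ℕ) :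
    Section16A.xi2 c' χ (q ^ (r + 1)) 1 1 =
      powI (Skeleton.b1 c' D) q ^ r * (powI (Skeleton.b1 c' D) q - 1) /
          (1 - powI (Skeleton.b1 c' D) q * (χ (q : ZMod D) / q)) -
        χ (q : ZMod D) * q / ((q : ℂ) - 1) * kappa₂ (Skeleton.b1 c' D) (q ^ r) := by
  unfold Section16A.xi2
  rw [Finset.filter_true_of_mem (fun k _ => Nat.coprime_one_right k), Nat.divisors_prime_pow hq,
    Finset.sum_map, Finset.sum_range_succ', Finset.sum_range_succ']
  have h0 : ∑ i ∈ Finset.range r,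
      (ArithmeticFunction.moebius (q ^ (i + 1 + 1)) : ℂ) * χ ((q ^ (i + 1 + 1) : ℕ) : ZMod D) *
        ((q ^ (i + 1 + 1) : ℕ) : ℂ) / (Nat.totient (q ^ (i + 1 + 1)) : ℂ) *
        Section16A.kappaTilde2 c' χ (q ^ (r + 1) / q ^ (i + 1 + 1)) (1 * q ^ (i + 1 + 1)) 1 = 0 := by
    refine Finset.sum_eq_zero fun i _ => ?_
    have h2 : ¬ Squarefree (q ^ (i + 1 + 1)) := by
      rw [pow_add, pow_one]
      exact fun h => hq.one_lt.ne' (Nat.isUnit_iff.mp (h q ⟨q ^ i, by ring⟩))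
    rw [ArithmeticFunction.moebius_eq_zero_of_not_squarefree h2]
    simp
  simp only [Function.Embedding.coeFn_mk] at h0 ⊢
  rw [h0, zero_add, pow_zero, pow_one, Nat.div_one, one_mul, one_mul,
    Nat.div_eq_of_eq_mul_left hq.pos (pow_succ q r),
    kappaTilde2_prime_pow_succ_one c' χ hq r, kappaTilde2_prime_pow_q c' χ hq r,
    ArithmeticFunction.moebius_apply_prime hq, ArithmeticFunction.moebius_apply_one,
    Nat.totient_prime hq, Nat.totient_one, Section16A.kappa2, Nat.cast_one, map_one]
  have hq1 : ((q - 1 : ℕ) : ℂ) = (q : ℂ) - 1 := by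
    rw [Nat.cast_sub hq.one_lt.le, Nat.cast_one]
  rw [hq1]
  push_cast
  ring

/-- **`λ̃₂(q,1) = λ₂(q) = (1 − χ(q)q^{−β₁}/q)/(1 − χ(q)/q)`** = `locLam` (§16 u014, (16.8) at a prime).
[cite: Zhang2022LandauSiegel, §16 (16.8) p. 91] -/
theorem lamTilde2_prime_one {q : ℕ} (hq : q.Prime) :
    Section16A.lamTilde2 c' χ q 1 =
      locLam (χ (q : ZMod D)) ((q : ℂ) ^ (-Skeleton.beta1 c' D)) q := by
  have hq0 : (q : ℂ) ≠ 0 := by exact_mod_cast hq.ne_zero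
  unfold Section16A.lamTilde2 Section16A.lam2 locLam
  rw [Finset.filter_true_of_mem (fun k _ => Nat.coprime_one_right k), hq.primeFactors,
    Finset.prod_singleton, hq.primeFactors, Finset.prod_singleton, neg_add, Complex.cpow_add _ _ hq0,
    Complex.cpow_neg_one]
  ring

/-- Summability of the two pieces of the local series: `j ↦ (wx)ʲ` and `j ↦ κ₂(qʲ)xʲ` for `‖x‖ < 1`.
[cite: Zhang2022LandauSiegel, App. A p. 105] -/
theorem summable_kappa₂_prime_pow_mul_pow' (b : ℝ) {q : ℕ} (hq : q.Prime) {x : ℂ} (hx : ‖x‖ < 1) :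
    Summable fun j : ℕ => kappa₂ b (q ^ j) * x ^ j := by
  refine Summable.of_norm_bounded (g := fun j => 2 * ‖x‖ ^ j)
    ((summable_geometric_of_lt_one (norm_nonneg _) hx).mul_left 2) fun j => ?_
  rw [norm_mul, norm_pow]
  exact mul_le_mul_of_nonneg_right (norm_kappa₂_prime_pow_le_two b hq j) (by positivity)

/-- `Σ_{j≥0} κ₂(qʲ)xʲ = (1 − x)/(1 − wx)` (`‖x‖ < 1`): the generating series of `κ₂` at the prime `q`.
[cite: Zhang2022LandauSiegel, App. A p. 105] -/
theorem tsum_kappa₂_prime_pow_mul_pow_zero (b : ℝ) {q : ℕ} (hq : q.Prime) {x : ℂ} (hx : ‖x‖ < 1) :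
    ∑' j : ℕ, kappa₂ b (q ^ j) * x ^ j = (1 - x) / (1 - powI b q * x) := by
  have hw : ‖powI b q‖ = 1 := norm_powI_of_pos b hq.pos
  have hwx : 1 - powI b q * x ≠ 0 := by
    intro h
    have : ‖powI b q * x‖ = 1 := by rw [← sub_eq_zero.mp h, norm_one]
    rw [norm_mul, hw, one_mul] at this
    linarith
  have hwx' : 1 - x * powI b q ≠ 0 := by rwa [mul_comm] at hwx
  rw [(summable_kappa₂_prime_pow_mul_pow' b hq hx).tsum_eq_zero_add, pow_zero, pow_zero,
    kappa₂_apply_one, one_mul]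
  have e : ∀ j : ℕ, kappa₂ b (q ^ (j + 1)) * x ^ (j + 1) = x * (kappa₂ b (q ^ (0 + 1 + j)) * x ^ j) :=
    fun j => by rw [show 0 + 1 + j = j + 1 by ring, pow_succ]; ring
  simp_rw [e]
  rw [tsum_mul_left, tsum_kappa₂_prime_pow_mul_pow b hq 0 hx, pow_zero, one_mul]
  field_simp
  ring

/-- **The typed local series is the closed form**: `xi2LocalSeries c′ χ q 1 1 s = locSer (χ q) (q^{−β₁}) (q^{−s}) q`
for `‖q^{−s}‖ < 1` (App. A p. 105: the two geometric series behind
"`1 + λ̃₂Σ_rξ₂(qʳ;d,l)q^{−rs} = 1 − χ(q)/(q−1) + O(α log q/q)`").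
[cite: Zhang2022LandauSiegel, App. A p. 105] -/
theorem xi2LocalSeries_prime_one_one {q : ℕ} (hq : q.Prime) (s : ℂ) (hx : ‖(q : ℂ) ^ (-s)‖ < 1) :
    Section16A.xi2LocalSeries c' χ q 1 1 s =
      locSer (χ (q : ZMod D)) ((q : ℂ) ^ (-Skeleton.beta1 c' D)) ((q : ℂ) ^ (-s)) q := by
  have hq0 : (q : ℂ) ≠ 0 := by exact_mod_cast hq.ne_zero
  have hwβ : (q : ℂ) ^ (-Skeleton.beta1 c' D) = powI (Skeleton.b1 c' D) q :=
    cpow_neg_beta1_eq_powI c' hq.ne_zero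
  have hwn : ‖powI (Skeleton.b1 c' D) q‖ = 1 := norm_powI_of_pos _ hq.pos
  have hwx : ‖powI (Skeleton.b1 c' D) q * (q : ℂ) ^ (-s)‖ < 1 := by rw [norm_mul, hwn, one_mul]; exact hx
  have hv1 := DirichletCharacter.norm_le_one χ (q : ZMod D)
  have hq2 : (2 : ℝ) ≤ q := by exact_mod_cast hq.two_le
  -- nonvanishing denominators
  have d1 : 1 - powI (Skeleton.b1 c' D) q * (q : ℂ) ^ (-s) ≠ 0 := by
    intro h
    have : ‖powI (Skeleton.b1 c' D) q * (q : ℂ) ^ (-s)‖ = 1 := by rw [← sub_eq_zero.mp h, norm_one]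
    linarith
  have d1' : 1 - (q : ℂ) ^ (-s) * powI (Skeleton.b1 c' D) q ≠ 0 := by rwa [mul_comm] at d1
  have d2 : (q : ℂ) - 1 ≠ 0 := sub_ne_zero.mpr (by exact_mod_cast hq.one_lt.ne')
  have d3 : 1 - powI (Skeleton.b1 c' D) q * (χ (q : ZMod D) / q) ≠ 0 := by
    intro h
    have h1 : ‖powI (Skeleton.b1 c' D) q * (χ (q : ZMod D) / q)‖ = 1 := by
      rw [← sub_eq_zero.mp h, norm_one]
    rw [norm_mul, hwn, one_mul, norm_div, Complex.norm_natCast, div_eq_one_iff_eq (by linarith)] at h1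
    linarith
  have d3' : 1 - powI (Skeleton.b1 c' D) q * χ (q : ZMod D) / q ≠ 0 := by rwa [mul_div_assoc]
  have d3'' : 1 - χ (q : ZMod D) * powI (Skeleton.b1 c' D) q / q ≠ 0 := by rwa [mul_comm] at d3'
  -- the terms of the series: `q^{−rs} = (q^{−s})^r`
  have term : ∀ r : ℕ, (if r = 0 then (0 : ℂ) else
      Section16A.xi2 c' χ (q ^ r) 1 1 / (q : ℂ) ^ ((r : ℂ) * s)) =
      if r = 0 then 0 else Section16A.xi2 c' χ (q ^ r) 1 1 * ((q : ℂ) ^ (-s)) ^ r := fun r => by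
    split_ifs
    · rfl
    · rw [Complex.cpow_nat_mul, div_eq_mul_inv, ← inv_pow, ← Complex.cpow_neg]
  unfold Section16A.xi2LocalSeries
  simp_rw [term]
  -- the shifted terms in closed form
  have ea : ∀ j : ℕ, Section16A.xi2 c' χ (q ^ (j + 1)) 1 1 * ((q : ℂ) ^ (-s)) ^ (j + 1) =
      (powI (Skeleton.b1 c' D) q - 1) / (1 - powI (Skeleton.b1 c' D) q * (χ (q : ZMod D) / q)) *
          (q : ℂ) ^ (-s) * (powI (Skeleton.b1 c' D) q * (q : ℂ) ^ (-s)) ^ j -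
        χ (q : ZMod D) * q / ((q : ℂ) - 1) * (q : ℂ) ^ (-s) *
          (kappa₂ (Skeleton.b1 c' D) (q ^ j) * ((q : ℂ) ^ (-s)) ^ j) := fun j => by
    rw [xi2_prime_pow_succ_one_one c' χ hq j, pow_succ, mul_pow]; ring
  have hsum : Summable fun j : ℕ =>
      Section16A.xi2 c' χ (q ^ (j + 1)) 1 1 * ((q : ℂ) ^ (-s)) ^ (j + 1) := by
    simp_rw [ea]
    exact ((summable_geometric_of_norm_lt_one hwx).mul_left _).sub
      ((summable_kappa₂_prime_pow_mul_pow' (Skeleton.b1 c' D) hq hx).mul_left _)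
  have hsf : Summable fun r : ℕ =>
      if r = 0 then (0 : ℂ) else Section16A.xi2 c' χ (q ^ r) 1 1 * ((q : ℂ) ^ (-s)) ^ r :=
    (summable_nat_add_iff 1).mp (hsum.congr fun j => (if_neg (Nat.succ_ne_zero j)).symm)
  rw [hsf.tsum_eq_zero_add, if_pos rfl, zero_add]
  have e1 : ∀ j : ℕ, (if j + 1 = 0 then (0 : ℂ) else
      Section16A.xi2 c' χ (q ^ (j + 1)) 1 1 * ((q : ℂ) ^ (-s)) ^ (j + 1)) =
      Section16A.xi2 c' χ (q ^ (j + 1)) 1 1 * ((q : ℂ) ^ (-s)) ^ (j + 1) :=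
    fun j => if_neg (Nat.succ_ne_zero j)
  simp_rw [e1, ea]
  rw [((summable_geometric_of_norm_lt_one hwx).mul_left _).tsum_sub
      ((summable_kappa₂_prime_pow_mul_pow' (Skeleton.b1 c' D) hq hx).mul_left _),
    tsum_mul_left, tsum_mul_left, tsum_geometric_of_norm_lt_one hwx,
    tsum_kappa₂_prime_pow_mul_pow_zero (Skeleton.b1 c' D) hq hx, hwβ]
  unfold locSer
  field_simp

/-- **The typed Euler factor at `d = l = 1` is the closed form**:
`calM2Factor c′ χ q 1 1 s = locF (χ q) (q^{−β₁}) (q^{−s}) q` (`q` prime, `‖q^{−s}‖ < 1`).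
[cite: Zhang2022LandauSiegel, §16 p. 91, App. A p. 105] -/
theorem calM2Factor_prime_one_one {q : ℕ} (hq : q.Prime) (s : ℂ) (hx : ‖(q : ℂ) ^ (-s)‖ < 1) :
    Section16A.calM2Factor c' χ q 1 1 s =
      locF (χ (q : ZMod D)) ((q : ℂ) ^ (-Skeleton.beta1 c' D)) ((q : ℂ) ^ (-s)) q := by
  have hq0 : (q : ℂ) ≠ 0 := by exact_mod_cast hq.ne_zero
  unfold Section16A.calM2Factor locF locPref
  rw [xi2LocalSeries_prime_one_one c' χ hq s hx, lamTilde2_prime_one c' χ hq, neg_add,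
    Complex.cpow_add _ _ hq0]
  ring

/-- **`frakpFactor χ q = locMain (χ q) q`**: L4-t5's factor of `𝔭` is the main term `M_q`.
[cite: Zhang2022LandauSiegel, §16 Lemma 16.1 p. 92] -/
theorem frakpFactor_eq_locMain (q : ℕ) :
    Section16B.frakpFactor χ q = locMain (χ (q : ZMod D)) q := by
  unfold Section16B.frakpFactor locMain
  rw [div_eq_mul_inv (1 - _) (1 - _), mul_comm, div_eq_mul_inv (χ _) (q : ℂ)]

end TypedBridge


end Literature.NumberTheory.LFunctions.Zhang2022.AppendixA
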